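import Mathlib
import Summits.AtomisticToContinuum.FouriersLaw.Theorems.OddSectorIrreversibilityBoundedResponseConvergesEscapeDeficitForm

/-!
# Stub `stub_escapeDeficitPos` of line `escape-deficit-dichotomy`
# (crux stmt-AtomisticToContinuum-9141, `OddSectorIrreversibility.BoundedResponseConverges`)

**Positivity of the escape deficit.** For the pinned anharmonic chain `pinnedChain ω₂ lam β γ` (all four
parameters `> 0`) and every temperature `T > 0`, the escape deficit
`E_N = 1 - (γ/T²) ∫_{(0,∞)} K_N(u) du`, `K_N(u) = ∫ (p₀² - T) · P_u(p₀² - T) dμ_T` (Gibbs measure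
`gibbsMeasure N T`, equal-temperature kernels `transitionKernel N T T u⁺`; kernel `0` for `N = 0`), is strictly
positive for every `N ≥ 2`. This is stub 1 of the birth skeleton of item `EscapeNonOscillation`
(stmt-AtomisticToContinuum-12238), up to name qualification.

Proof (D-side, assembled from landed theorems): run the canonical steady-state family
(`pinnedChain_exists_isSteadyState`) under weak-NESS uniqueness (`nessUnique_proof`); the landed response identity
(`responseIdentity_proof`) says the clause-(ii) response coefficient at length `N ≥ 1` is
`D_N = (N-1)·γ·E_N` (and the empty chain carries no current, `D_0 = 0`); positive conductance
(`positiveConductance_holds`, = `FeketeSeriesLaw.PositiveConductance`) gives `D_N > 0` for `N ≥ 2`; since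
`(N-1)·γ > 0` there, `E_N > 0`. No definitions, no named-fact hypotheses; standard axioms.
-/

noncomputable section

open MeasureTheory Filter Topology Set

namespace Summit.AtomisticToContinuum.FouriersLaw.Theorems.EscapeDeficitDichotomy

open Literature.MathematicalPhysics.KineticTheory.HeatConduction
open Summit.AtomisticToContinuum.FouriersLaw.Theses

/-- **Stub `stub_escapeDeficitPos`, PROVED — positivity of the escape deficit.** For `pinnedChain ω₂ lam β γ`
(all `> 0`), `T > 0` and every `N ≥ 2`: if `E` is the escape-deficit sequence
(`E N = 1 - (γ/T²)∫_{u>0} K_N(u)`, verbatim the route's `let E`), then `0 < E N`. The response coefficient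
along the canonical steady-state family is `D_N = (N-1)·γ·E_N` (`responseIdentity_proof`, under
`nessUnique_proof`) and `D_N > 0` for `N ≥ 2` (`positiveConductance_holds`).
[cite: KunduDharNarayan2009, arXiv:0809.4543 p. 3] [cite: ReyBellet2003, Rem. 4.4] -/
theorem stub_escapeDeficitPos : ∀ ω₂ lam β γ : ℝ, 0 < ω₂ → 0 < lam → 0 < β → 0 < γ → ∀ T : ℝ, 0 < T → ∀ E : ℕ → ℝ, (∀ N : ℕ, E N = 1 - γ / T ^ 2 * ∫ u in Set.Ioi (0 : ℝ), (if h : 0 < N then ∫ z, ((z.2 ⟨0, h⟩) ^ 2 - T) * (∫ y, ((y.2 ⟨0, h⟩) ^ 2 - T) ∂((Literature.MathematicalPhysics.KineticTheory.HeatConduction.pinnedChain ω₂ lam β γ).transitionKernel N T T u.toNNReal z)) ∂((Literature.MathematicalPhysics.KineticTheory.HeatConduction.pinnedChain ω₂ lam β γ).gibbsMeasure N T) else 0)) → ∀ N : ℕ, 2 ≤ N → 0 < E N := by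
  intro ω₂ lam β γ hω hl hβ hγ T hT E hE N hN
  -- weak-NESS uniqueness (landed)
  have hU : ∀ (N : ℕ) (T_L T_R : ℝ), 0 < T_L → 0 < T_R → ∀ μ ν : Measure (PhaseSpace N),
      (pinnedChain ω₂ lam β γ).IsSteadyState N T_L T_R μ →
        (pinnedChain ω₂ lam β γ).IsSteadyState N T_L T_R ν → μ = ν :=
    nessUnique_proof ω₂ lam β γ hω hl hβ hγ
  classical
  -- the canonical steady-state family
  set μc : (N : ℕ) → ℝ → ℝ → Measure (PhaseSpace N) := fun N T_L T_R =>
    if h : 0 < T_L ∧ 0 < T_R then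
      Classical.choose (pinnedChain_exists_isSteadyState hω hl hβ hγ N h.1 h.2) else 0 with hμc
  have hμc' : ∀ (N : ℕ) (T_L T_R : ℝ), 0 < T_L → 0 < T_R →
      (pinnedChain ω₂ lam β γ).IsSteadyState N T_L T_R (μc N T_L T_R) := by
    intro N T_L T_R hL hR
    have h : 0 < T_L ∧ 0 < T_R := ⟨hL, hR⟩
    simp only [hμc, dif_pos h]
    exact Classical.choose_spec (pinnedChain_exists_isSteadyState hω hl hβ hγ N h.1 h.2)
  -- the response sequence along the canonical family: `(N-1)·γ·E N` for `N ≥ 1`, `0` for the empty chain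
  set D : ℕ → ℝ := fun N => if 0 < N then ((N : ℝ) - 1) * γ * E N else 0 with hDdef
  have hDe : ∀ N : ℕ, 0 < N → D N = ((N : ℝ) - 1) * γ * E N := fun N hN => by
    simp only [hDdef, if_pos hN]
  have hresp : ∀ N : ℕ, Tendsto (fun δ : ℝ =>
      (pinnedChain ω₂ lam β γ).totalCurrent (μc N (T + δ / 2) (T - δ / 2)) / δ) (𝓝[≠] 0) (𝓝 (D N)) := by
    intro N
    rcases Nat.eq_zero_or_pos N with rfl | hN
    · have h0 : (fun δ : ℝ => (pinnedChain ω₂ lam β γ).totalCurrent (μc 0 (T + δ / 2) (T - δ / 2)) / δ) =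
          fun _ => 0 := by
        funext δ; rw [OscillatorChain.totalCurrent_zero, zero_div]
      rw [h0]
      simp only [hDdef, lt_self_iff_false, if_false]
      exact tendsto_const_nhds
    · have h := Summit.AtomisticToContinuum.FouriersLaw.Cruxes.SuperadditiveResistance.ThermaliseThenCutProbeInsertion.responseIdentity_proof
        ω₂ lam β γ hω hl hβ hγ hU μc hμc' T hT
      dsimp only at h
      obtain ⟨-, hlim⟩ := h N hN
      simp only [dif_pos hN] at hlim
      rw [hDe N hN, hE N]
      simp only [dif_pos hN]
      exact hlim
  -- positive conductance: `0 < D N` for `N ≥ 2`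
  have hP := Summit.AtomisticToContinuum.FouriersLaw.Cruxes.BoundedResponseConverges.TwoScaleGluingLogRigidity.Stubs.positiveConductance_holds
    ω₂ lam β γ hω hl hβ hγ hU μc hμc' T hT D hresp N hN
  have hN0 : 0 < N := by omega
  rw [hDe N hN0] at hP
  -- divide off the positive factor `(N-1)·γ`
  have hc : 0 < ((N : ℝ) - 1) * γ := by
    have h2 : (2 : ℝ) ≤ N := by exact_mod_cast hN
    exact mul_pos (by linarith) hγ
  exact pos_of_mul_pos_right hP hc.le

end Summit.AtomisticToContinuum.FouriersLaw.Theorems.EscapeDeficitDichotomy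

end
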